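import Summits.BirchSwinnertonDyer.BirchSwinnertonDyer.Theorems.PrintCf2SplitBadTwoRestrictedSelmerBottomLocalKummerRankOne
import HarnessLib

/-!
# Crux `PrintCf2.SplitBadTwoRankOneOfFacts` (stmt-BirchSwinnertonDyer-20368), road α v10.3 — S3c (R-BV) factor (F1), piece (C):
# LOCAL KUMMER THEORY AT A PLACE `w`: `loc_w(res_⊤ κ_N(P)) = 0` in `H¹(⊤ ⊓ D_w, E[p^∞])` ⟺ `P ∈ p^N E(K_w) + E(K_w)_tors`

Cell `bsd-print-cf2`, width seat `bsd-line-cf2-p1-w6` g3 (prover-bsd-line-cf2-p1-w6-g3-0). `--supports stmt-BirchSwinnertonDyer-20368`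
(helper, Theses-free, GENERIC `V/K`, `p`, `w`, `P`, `N`). HONEST FRAMING: nothing here closes the crux or a registered stub; BSD is not proved
by any of this; no summit statement is proved by this seat. No definition, no named fact, no `sorry`.

WHAT. (F1) `v₂ #(Q_M ⊓ ker loc_{v̄}) = ℓ + e₁([d]₂)` counts the levels `N` at which the Kummer class of the ℚ-generator dies on `D_{v̄}`; piece (B)
(`resOfLe_kummer_eq_zero_iff_proj_of_frame`) removed the projector, so the local condition is about `res_⊤ κ_N(P_K) ∈ H¹(⊤, E[2^∞])` itself.
THIS FILE is the point-level dictionary, for an elliptic curve `V` over a number field `K`, a prime `p`, a finite place `w`, `P ∈ E(K)`, `N`: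
* `resOfLe_resSubgroup_kummerMapLevel_eq_zero_iff_exists` — cocycle form: `loc_w(res_⊤ κ_N(P)) = 0 ⟺ ∃ a ∈ E[p^∞](K̄), ∀ δ ∈ D_w,
  δQ − Q = δa − a` (`p^N Q = P`; tree `resOfLe_oneCocycleClass_eq_zero_iff`);
* **`resOfLe_resSubgroup_kummerMapLevel_eq_zero_iff`** — POINT form: `loc_w(res_⊤ κ_N(P)) = 0 ⟺ ∃ y, T ∈ E(K̄_w)`, `y` fixed by `Γ_{K_w}`,
  `T` of finite order, `p^N y + T = P` in `E(K̄_w)` — i.e. `P ∈ p^N E(K_w) + E(K_w)_tors`.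
  (⟹: `y = Q − a`, `T = p^N a`. ⟸: `X = Q − y` has `p^N X = T`, so `X` is torsion, hence ALGEBRAIC (`torsionPointsEquiv`), `X = t`; split
  `t = a + a′` into its `p`-part `a` and prime-to-`p` part `a′` (Bézout); `δQ − Q = δt − t` and the prime-to-`p` contribution `δa′ − a′` is killed
  by a power of `p` and by an integer prime to `p`, hence vanishes.)
presearch: Silverman AEC VIII §2 (Kummer pairing, local version X §4), Greenberg LNM 1716 §2 p. 62 (`Im κ_v = E(K_v) ⊗ ℚ_p/ℤ_p`) — the
statement is the definition-level exactness of the local Kummer sequence; held; nothing filed. beyond-print theorem: no.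

References: [SilvermanAEC2009] VIII §2, X §4; [GreenbergLNM1716] §2 Prop. 2.1 and p. 62; [SerreGaloisCohomology1997] I §2.4–2.5.
-/

noncomputable section

open scoped Classical

set_option linter.dupNamespace false
set_option autoImplicit false

open NumberField IsDedekindDomain Field WeierstrassCurve
open Literature.NumberTheory.EllipticCurves Literature.NumberTheory.EllipticCurves.GreenbergSelmer
open Literature.NumberTheory.EllipticCurves.ResKernel Literature.NumberTheory.EllipticCurves.CocycleCriteria
open Literature.NumberTheory.GaloisRepresentations

universe u

namespace Summit.BirchSwinnertonDyer.BirchSwinnertonDyer.Theorems.PrintCf2.RestrictedSelmerPair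

section LocalKummer

variable {K : Type u} [Field K] [NumberField K] (V : WeierstrassCurve K) [V.IsElliptic] (p : ℕ) [Fact p.Prime]
  (w : HeightOneSpectrum (𝓞 K)) (P : V.toAffine.Point) (N : ℕ)

/-- Bézout splitting of a torsion point: if `(p^k * m) • t = 0` with `p ∤ m` then `t = a + a′` with `p^k • a = 0` and `m • a′ = 0`. [folklore] -/
theorem exists_add_eq_of_pow_mul_smul_eq_zero {A : Type*} [AddCommGroup A] {t : A} {k m : ℕ} (hm : ¬ p ∣ m)
    (ht : (p ^ k * m) • t = 0) : ∃ a a' : A, p ^ k • a = 0 ∧ m • a' = 0 ∧ a + a' = t := by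
  have hcop : IsCoprime ((p : ℤ) ^ k) (m : ℤ) := by
    have h : Nat.Coprime (p ^ k) m := ((Nat.Prime.coprime_iff_not_dvd (Fact.out : p.Prime)).mpr hm).pow_left k
    exact_mod_cast Nat.isCoprime_iff_coprime.mpr h
  obtain ⟨u, v, huv⟩ := hcop
  refine ⟨(v * m) • t, (u * (p : ℤ) ^ k) • t, ?_, ?_, ?_⟩
  · rw [← natCast_zsmul, smul_smul, show ((p ^ k : ℕ) : ℤ) * (v * m) = v * ((p ^ k * m : ℕ) : ℤ) by push_cast; ring,
      ← smul_smul, natCast_zsmul, ht, zsmul_zero]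
  · rw [← natCast_zsmul, smul_smul, show (m : ℤ) * (u * (p : ℤ) ^ k) = u * ((p ^ k * m : ℕ) : ℤ) by push_cast; ring,
      ← smul_smul, natCast_zsmul, ht, zsmul_zero]
  · rw [← add_zsmul, show v * (m : ℤ) + u * (p : ℤ) ^ k = 1 by linear_combination huv, one_zsmul]

/-- **Cocycle form**: `loc_w(res_⊤ κ_N(P)) = 0` in `H¹(⊤ ⊓ D_w, E[p^∞])` iff the Kummer cocycle `δ ↦ δQ − Q` (`p^N Q = P`) is the coboundary
on `D_w` of a `p`-power torsion point `a`. [cite: SerreGaloisCohomology1997, I §2.4–2.5] [cite: SilvermanAEC2009, VIII §2] -/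
theorem resOfLe_resSubgroup_kummerMapLevel_eq_zero_iff_exists :
    resOfLe (V.geomPrimaryTorsion p) (inf_le_left : ⊤ ⊓ decomp w ≤ ⊤)
        (resSubgroup ⊤ (V.geomPrimaryTorsion p) (V.kummerMapLevel p V.zsmul_geomPoints_surjective_holds N P)) = 0 ↔
      ∃ a : V.geomPrimaryTorsion p, ∀ δ ∈ decomp w,
        δ • V.kummerRoot p V.zsmul_geomPoints_surjective_holds N P - V.kummerRoot p V.zsmul_geomPoints_surjective_holds N P =
          δ • (a : V.geomPoints) - a := by
  set QP := V.kummerRoot p V.zsmul_geomPoints_surjective_holds N P with hQP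
  have hnQP : p ^ N • QP = toGeomPoints V P := V.nsmul_kummerRoot p V.zsmul_geomPoints_surjective_holds N P
  have hQPfix : ∀ σ : absoluteGaloisGroup K, σ • (p ^ N • QP) = p ^ N • QP := smul_nsmul_of_nsmul_eq V p hnQP
  set ψP := contOneCocycles.pullback (Literature.NumberTheory.EllipticCurves.subgroupIncl (⊤ : Subgroup (absoluteGaloisGroup K)))
    (resHomOfEquivariant (Literature.NumberTheory.EllipticCurves.subgroupIncl (⊤ : Subgroup (absoluteGaloisGroup K)))
      (AddMonoidHom.id (V.geomPrimaryTorsion p)) (fun _ _ ↦ rfl)) (V.kummerCocycle p N QP hQPfix) with hψP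
  have hκ : resSubgroup ⊤ (V.geomPrimaryTorsion p) (V.kummerMapLevel p V.zsmul_geomPoints_surjective_holds N P) =
      oneCocycleClass _ ψP := by
    rw [hψP, ← resSubgroup_oneCocycleClass]
    rfl
  have hψP_apply : ∀ g : (⊤ : Subgroup (absoluteGaloisGroup K)), ((ψP.1 g : V.geomPrimaryTorsion p) : V.geomPoints) =
      (g : absoluteGaloisGroup K) • QP - QP := fun g ↦ rfl
  rw [hκ, resOfLe_oneCocycleClass_eq_zero_iff]
  constructor
  · rintro ⟨a, ha⟩
    refine ⟨a, fun δ hδ ↦ ?_⟩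
    have h := congrArg (fun x : V.geomPrimaryTorsion p ↦ (x : V.geomPoints))
      (ha ⟨δ, Subgroup.mem_inf.mpr ⟨Subgroup.mem_top δ, hδ⟩⟩)
    simp only [hψP_apply, AddSubgroupClass.coe_sub, Literature.NumberTheory.EllipticCurves.primaryComponent.coe_smul] at h
    exact h
  · rintro ⟨a, ha⟩
    refine ⟨a, fun g ↦ Subtype.ext ?_⟩
    rw [AddSubgroupClass.coe_sub, Literature.NumberTheory.EllipticCurves.primaryComponent.coe_smul, hψP_apply]
    exact ha _ (Subgroup.mem_inf.mp g.2).2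

/-- **LOCAL KUMMER THEORY AT `w` (point form).** For an elliptic curve `V` over a number field `K`, a prime `p`, a finite place `w`,
`P ∈ E(K)` and `N`: the restriction of the level-`N` Kummer class of `P` to the decomposition group `D_w` vanishes in
`H¹(⊤ ⊓ D_w, E[p^∞])` IF AND ONLY IF `P = p^N y + T` in `E(K̄_w)` with `y` fixed by `Γ_{K_w}` (i.e. `y ∈ E(K_w)`) and `T` of finite order:
`P ∈ p^N E(K_w) + E(K_w)_tors`. [cite: SilvermanAEC2009, VIII §2 and X §4] [cite: GreenbergLNM1716, §2 Prop. 2.1 and p. 62] -/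
theorem resOfLe_resSubgroup_kummerMapLevel_eq_zero_iff :
    resOfLe (V.geomPrimaryTorsion p) (inf_le_left : ⊤ ⊓ decomp w ≤ ⊤)
        (resSubgroup ⊤ (V.geomPrimaryTorsion p) (V.kummerMapLevel p V.zsmul_geomPoints_surjective_holds N P)) = 0 ↔
      ∃ y T : localPoints V (w.adicCompletion K), (∀ σ : absoluteGaloisGroup (w.adicCompletion K), σ • y = y) ∧
        IsOfFinAddOrder T ∧ p ^ N • y + T = pointsMap V (w.adicCompletion K) (toGeomPoints V P) := by
  set E := w.adicCompletion K with hE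
  set QP := V.kummerRoot p V.zsmul_geomPoints_surjective_holds N P with hQP
  have hnQP : p ^ N • QP = toGeomPoints V P := V.nsmul_kummerRoot p V.zsmul_geomPoints_surjective_holds N P
  rw [resOfLe_resSubgroup_kummerMapLevel_eq_zero_iff_exists]
  constructor
  · -- ⟹: `y = Q − a`, `T = p^N a`
    rintro ⟨a, ha⟩
    obtain ⟨k, hk⟩ := (AddCommGroup.mem_primaryComponent).mp a.2
    refine ⟨pointsMap V E (QP - a), pointsMap V E (p ^ N • (a : V.geomPoints)), fun σ ↦ ?_, ?_, ?_⟩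
    · rw [← pointsMap_smul]
      congr 1
      have hmem : resGal (K := K) E σ ∈ decomp w := (mem_decomp_iff w _).mpr ⟨σ, rfl⟩
      have h := ha _ hmem
      rw [smul_sub, sub_eq_sub_iff_sub_eq_sub]
      exact h
    · refine isOfFinAddOrder_iff_nsmul_eq_zero.mpr ⟨p ^ k, pow_pos (Fact.out : p.Prime).pos k, ?_⟩
      rw [← map_nsmul, smul_comm, hk, smul_zero, map_zero]
    · rw [← map_nsmul, ← map_add, smul_sub, sub_add_cancel, hnQP]
  · -- ⟸: `X = Q − y` is torsion, hence algebraic; split off its `p`-part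
    rintro ⟨y, T, hy, hT, heq⟩
    obtain ⟨m, hm0, hmT⟩ := isOfFinAddOrder_iff_nsmul_eq_zero.mp hT
    obtain ⟨j, m', hm', hmm'⟩ := Nat.exists_eq_pow_mul_and_not_dvd hm0.ne' p (Fact.out : p.Prime).ne_one
    set X : localPoints V E := pointsMap V E QP - y with hXdef
    have hNX : p ^ N • X = T := by
      rw [hXdef, smul_sub, ← map_nsmul, hnQP, ← heq, add_sub_cancel_left]
    -- `X` is killed by `n₀ = p^(N+j) * m'`
    have hX0 : (p ^ (N + j) * m') • X = 0 := by
      rw [show p ^ (N + j) * m' = m * p ^ N by rw [hmm']; ring, mul_smul, hNX, hmT]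
    have hnz : ((p ^ (N + j) * m' : ℕ) : ℤ) ≠ 0 := by
      have : 0 < p ^ (N + j) * m' := by
        refine Nat.mul_pos (pow_pos (Fact.out : p.Prime).pos _) (Nat.pos_of_ne_zero ?_)
        rintro rfl; exact hm' (dvd_zero p)
      exact_mod_cast this.ne'
    set Xt : AddSubgroup.torsionBy (localPoints V E) ((p ^ (N + j) * m' : ℕ) : ℤ) :=
      ⟨X, by change ((p ^ (N + j) * m' : ℕ) : ℤ) • X = 0; rw [natCast_zsmul]; exact hX0⟩ with hXt
    set t : V.geomTorsion ((p ^ (N + j) * m' : ℕ) : ℤ) := (V.torsionPointsEquiv ((p ^ (N + j) * m' : ℕ) : ℤ) (E := E) hnz).symm Xt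
      with htdef
    have ht : pointsMap V E (t : V.geomPoints) = X := by rw [htdef, V.pointsMap_torsionPointsEquiv_symm]
    have ht0 : (p ^ (N + j) * m') • (t : V.geomPoints) = 0 := by
      have h2 := t.2
      change ((p ^ (N + j) * m' : ℕ) : ℤ) • (t : V.geomPoints) = 0 at h2
      rwa [natCast_zsmul] at h2
    obtain ⟨a, a', hpa, hma', hsum⟩ := exists_add_eq_of_pow_mul_smul_eq_zero p hm' ht0
    refine ⟨⟨a, (AddCommGroup.mem_primaryComponent).mpr ⟨N + j, hpa⟩⟩, fun δ hδ ↦ ?_⟩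
    obtain ⟨σ, hσ⟩ := (mem_decomp_iff w δ).mp hδ
    change δ • QP - QP = δ • a - a
    -- `δQ − Q = δt − t` (apply the injective `pointsMap`; `σ` fixes `y`)
    have hQt : δ • QP - QP = δ • (t : V.geomPoints) - t := by
      apply pointsMapOfEmb_injective V (closureEmb (K := K) E)
      change pointsMap V E (δ • QP - QP) = pointsMap V E (δ • (t : V.geomPoints) - t)
      rw [map_sub, map_sub, ← hσ]
      change pointsMap V E (resGal (K := K) E σ • QP) - pointsMap V E QP =
        pointsMap V E (resGal (K := K) E σ • (t : V.geomPoints)) - pointsMap V E (t : V.geomPoints)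
      rw [pointsMap_smul, pointsMap_smul, ht, hXdef, smul_sub, hy σ]
      abel
    -- the prime-to-`p` part contributes `D = δa′ − a′`, killed by `p^(N+j)` and by `m'`
    have hD : δ • QP - QP - (δ • a - a) = δ • a' - a' := by
      rw [hQt, ← hsum, smul_add]; abel
    have hfixQ : δ • (p ^ (N + j) • QP) = p ^ (N + j) • QP := by
      rw [pow_add, mul_comm, mul_smul, hnQP, ← map_nsmul, smul_toGeomPoints]
    have hpD : p ^ (N + j) • (δ • a' - a') = 0 := by
      rw [← hD, smul_sub, smul_sub, smul_sub, smul_comm (p ^ (N + j)) δ QP, hfixQ, smul_comm (p ^ (N + j)) δ a, hpa]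
      simp only [smul_zero, sub_self]
    have hmD : m' • (δ • a' - a') = 0 := by
      rw [smul_sub, smul_comm, hma', smul_zero, sub_self]
    have hcop : IsCoprime ((p : ℤ) ^ (N + j)) (m' : ℤ) := by
      have h : Nat.Coprime (p ^ (N + j)) m' := ((Nat.Prime.coprime_iff_not_dvd (Fact.out : p.Prime)).mpr hm').pow_left _
      exact_mod_cast Nat.isCoprime_iff_coprime.mpr h
    obtain ⟨u, v, huv⟩ := hcop
    have hD0 : δ • a' - a' = 0 := by
      calc δ • a' - a' = (1 : ℤ) • (δ • a' - a') := (one_zsmul _).symm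
        _ = (u * (p : ℤ) ^ (N + j) + v * (m' : ℤ)) • (δ • a' - a') := by rw [huv]
        _ = 0 := by
          rw [add_zsmul, mul_zsmul, mul_zsmul, ← Nat.cast_pow, natCast_zsmul, natCast_zsmul, hpD, hmD, zsmul_zero, zsmul_zero,
            add_zero]
    rw [← sub_eq_zero, hD, hD0]

end LocalKummer

end Summit.BirchSwinnertonDyer.BirchSwinnertonDyer.Theorems.PrintCf2.RestrictedSelmerPair

end
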